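import Mathlib
import HarnessLib
import Literature.NumberTheory.LFunctions.ZetaSubconvexity
import Literature.NumberTheory.LFunctions.SecondSpacingLemma
import Literature.NumberTheory.LFunctions.BourgainTheorem4SixthMoment

/-!
# The second spacing count of a family of Huxley–Watt blocks (PROVED)

Topic `Literature/NumberTheory/LFunctions`. The reduction of Bourgain's second spacing count `B_V`
((3.9), (3.14) of J. Bourgain, *Decoupling, exponential sums and the Riemann zeta function*, J. AMS
30 (2017), §4) for the vectors `x(I)` of the Huxley–Watt blocks of `∑ e(T log(m/M))` to the count
`B` of S. W. Graham–G. Kolesnik, *Van der Corput's Method of Exponential Sums* (1991), Lemma 7.18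
(`SecondSpacingLemma.lean`: `pairCount`, `GrahamKolesnik_lemma718_general`), as at the end of
their §7.7:

* `count_le_of_fibers`: blocks are mapped to their rationals `(-a, q) = (r, q)`; with at most `m₀`
  blocks per rational, `B_V ≤ m₀² #{good pairs of rationals}`.
* `invClose_of_x2`: the second coordinate is `x₂ ≡ -ā/(4q) (mod 1)` (`GaussSumQuadraticPhase`), so
  `|x₂ - x₂'| < 1/(12H²V)` forces (7.5.2) `|u/q - u₁/q₁| ≤ Δ₁ = 1/(3H²V)` for suitable inverses.
* `kap`, `cube_mul_kap_sq`, `abs_sub_le_of_kap`: the third coordinate is `x₃ = -κ`,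
  `κ = (2/3)T^{1/4}G^{-3/2}` with `G = q(2x)^{1/2}` (`x = T/(2m²)`, `μ = T/(3m³)`), and
  `|κ - κ'| < 1/(12H^{3/2})` forces `|G - G'| ≪ G₀ H^{-3/2}/κ₀` (pure algebra from `G³κ² = const`).
* `isSpacingFn_sqrt`: `h(x) = (2x)^{1/2}` satisfies the hypotheses of Lemma 7.18 (`xh' = h/2`).
* `secondSpacingCount_le_pairCount`, `secondSpacingCount_le`: for a family with numerators `∼ A`,
  denominators `∼ C`, points `η`-close to their rationals (`η ≤ A/4C`),
  `B_V ≤ m₀² · pairCount A C (1/(3H²V)) Δ₂ …  ≤ m₀² K ((Δ₁Δ₂ + Δ₁²)AC²(A+C) + AC + Δ₂(A² + C²))`,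
  `Δ₂ = delta2 T A C η H ≍ G₀H^{-3/2}/(κ₀ (AC)^{1/2}) + η C/A`.

Everything is PROVED; no named fact is introduced.

## References

* J. Bourgain, *Decoupling, exponential sums and the Riemann zeta function*, J. Amer. Math. Soc. 30
  (2017), 205–224 — §4, (3.9), (3.11), (3.14). [BourgainJAMS2017]
* S. W. Graham, G. Kolesnik, *Van der Corput's Method of Exponential Sums*, LMS Lecture Note Series
  126, Cambridge Univ. Press 1991 — §7.7 (end), Lemma 7.18. [GrahamKolesnik1991]
* M. N. Huxley, N. Watt, *Exponential sums and the Riemann zeta function*, Proc. London Math. Soc.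
  (3) 57 (1988), 1–24 — §4, Step 4; §5. [HuxleyWatt1988]
-/

noncomputable section

open Real Finset Set
open Literature.NumberTheory.LFunctions.SecondSpacing (points mem_points InvClose HClose goodPairs pairCount
  mem_goodPairs IsSpacingFn GrahamKolesnik_lemma718_general)

namespace Literature.NumberTheory.LFunctions
namespace SecondSpacingLog

/-! ### From pairs of blocks to pairs of rationals -/

/-- **Counting through a map with bounded fibres.** If `p` maps `𝓕` into `P`, each fibre has at most
`m₀` elements, and every pair of `𝓕` counted by `B` (all four coordinate conditions) is mapped to a
pair counted by `good ⊆ P × P`, then `B ≤ m₀² #good`. [folklore] -/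
theorem count_le_of_fibers {𝓕 : Finset ℕ} {x : ℕ → Fin 4 → ℝ} {H : ℕ} {V : ℝ} {p : ℕ → ℤ × ℤ}
    {P : Finset (ℤ × ℤ)} {good : Finset ((ℤ × ℤ) × (ℤ × ℤ))} {m₀ : ℕ}
    (hfib : ∀ pt ∈ P, (𝓕.filter (fun k => p k = pt)).card ≤ m₀)
    (hgood : ∀ k ∈ 𝓕, ∀ k' ∈ 𝓕, (∀ j, |x k j - x k' j| < (2 * bourgainYBound H V j)⁻¹) → (p k, p k') ∈ good)
    (hgoodP : good ⊆ P ×ˢ P) :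
    bourgainSecondSpacingCount 𝓕 x H V ≤ m₀ ^ 2 * good.card := by
  classical
  unfold bourgainSecondSpacingCount
  set S := (𝓕 ×ˢ 𝓕).filter fun pr => ∀ k, |x pr.1 k - x pr.2 k| < (2 * bourgainYBound H V k)⁻¹ with hS
  have hmap : ∀ pr ∈ S, (p pr.1, p pr.2) ∈ good := by
    intro pr hpr
    have h := (@Finset.mem_filter _ _ (_) _ _).1 hpr
    rw [Finset.mem_product] at h
    exact hgood pr.1 h.1.1 pr.2 h.1.2 h.2
  refine (Finset.card_le_mul_card_image_of_maps_to (f := fun pr : ℕ × ℕ => (p pr.1, p pr.2)) hmap (m₀ ^ 2) ?_)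
  intro b hb
  have hbP := Finset.mem_product.1 (hgoodP hb)
  calc (S.filter fun pr => (p pr.1, p pr.2) = b).card
      ≤ ((𝓕.filter fun k => p k = b.1) ×ˢ (𝓕.filter fun k => p k = b.2)).card := by
        refine Finset.card_le_card fun pr hpr => ?_
        have h := (@Finset.mem_filter _ _ (_) _ _).1 hpr
        have h1 := (@Finset.mem_filter _ _ (_) _ _).1 h.1
        rw [Finset.mem_product] at h1
        have hb1 : p pr.1 = b.1 := congrArg Prod.fst h.2
        have hb2 : p pr.2 = b.2 := congrArg Prod.snd h.2
        rw [Finset.mem_product, Finset.mem_filter, Finset.mem_filter]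
        exact ⟨⟨h1.1.1, hb1⟩, ⟨h1.1.2, hb2⟩⟩
    _ = (𝓕.filter fun k => p k = b.1).card * (𝓕.filter fun k => p k = b.2).card := Finset.card_product _ _
    _ ≤ m₀ * m₀ := Nat.mul_le_mul (hfib _ hbP.1) (hfib _ hbP.2)
    _ = m₀ ^ 2 := (sq m₀).symm

/-! ### The second coordinate: `x₂ ≡ -ā/(4q) (mod 1)` and (7.5.2) -/

/-- If `x₂ = -ā/(4q) - n`, `x₂' = -ā'/(4q') - n'` (integers `n, n'`, `aā ≡ 1 (q)`, `a'ā' ≡ 1 (q')`) and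
`|x₂ - x₂'| < ε`, then the inverses `-ā, -ā' - 4(n - n')q'` of `-a, -a'` satisfy
`|(-ā)/q - (-ā' - 4(n-n')q')/q'| < 4ε`: condition (7.5.2) with `Δ₁ = 4ε` for the points `(-a, q)`,
`(-a', q')`. [cite: GrahamKolesnik1991, §7.7 (7.5.2)] -/
theorem invClose_of_x2 {q q' : ℕ} (hq : 0 < q) (hq' : 0 < q') {a abar a' abar' n n' : ℤ}
    (hab : a * abar ≡ 1 [ZMOD q]) (hab' : a' * abar' ≡ 1 [ZMOD q']) {x₂ x₂' ε : ℝ}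
    (hx : x₂ = -(abar : ℝ) / (4 * q) - n) (hx' : x₂' = -(abar' : ℝ) / (4 * q') - n') (hε : |x₂ - x₂'| < ε) :
    InvClose (4 * ε) ((-a, (q : ℤ))) ((-a', (q' : ℤ))) := by
  refine ⟨-abar, -abar' + 4 * (n - n') * q', ?_, ?_, ?_⟩
  · show -a * -abar ≡ 1 [ZMOD (q : ℤ)]
    rw [neg_mul_neg]; exact hab
  · show -a' * (-abar' + 4 * (n - n') * q') ≡ 1 [ZMOD (q' : ℤ)]
    have : -a' * (-abar' + 4 * (n - n') * q') = a' * abar' + (q' : ℤ) * (-(4 * (n - n') * a')) := by ring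
    rw [this]
    calc a' * abar' + (q' : ℤ) * (-(4 * (n - n') * a')) ≡ 1 + 0 [ZMOD (q' : ℤ)] :=
          Int.ModEq.add hab' (Int.modEq_zero_iff_dvd.2 (dvd_mul_right _ _))
      _ = 1 := by ring
  · show |((-abar : ℤ) : ℝ) / (q : ℤ) - ((-abar' + 4 * (n - n') * q' : ℤ) : ℝ) / (q' : ℤ)| ≤ 4 * ε
    have hqR : (0 : ℝ) < q := by exact_mod_cast hq
    have hqR' : (0 : ℝ) < q' := by exact_mod_cast hq'
    have key : ((-abar : ℤ) : ℝ) / (q : ℤ) - ((-abar' + 4 * (n - n') * q' : ℤ) : ℝ) / (q' : ℤ) =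
        4 * (x₂ - x₂') := by
      rw [hx, hx']; push_cast; field_simp; ring
    rw [key, abs_mul, abs_of_pos (by norm_num : (0 : ℝ) < 4)]
    linarith [hε.le]

/-! ### The third coordinate: `x₃ = -κ`, `κ = (2/3) T^{1/4} G^{-3/2}`, `G = q (2x)^{1/2}` -/

/-- `G ↦ (2/3) T^{1/4} G^{-3/2}` written with square roots: `kap T G = (2/3) T^{1/4} / (G √G)`.
[folklore] -/
def kap (T G : ℝ) : ℝ := 2 / 3 * Real.sqrt (Real.sqrt T) / (G * Real.sqrt G)

/-- `kap` is positive. [folklore] -/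
theorem kap_pos {T G : ℝ} (hT : 0 < T) (hG : 0 < G) : 0 < kap T G := by
  unfold kap
  have : 0 < Real.sqrt (Real.sqrt T) := Real.sqrt_pos.2 (Real.sqrt_pos.2 hT)
  have : 0 < Real.sqrt G := Real.sqrt_pos.2 hG
  positivity

/-- `G³ · kap² = (4/9) √T`. [folklore] -/
theorem cube_mul_kap_sq (T : ℝ) {G : ℝ} (hG : 0 < G) : G ^ 3 * kap T G ^ 2 = 4 / 9 * Real.sqrt T := by
  unfold kap
  have hsG : Real.sqrt G ^ 2 = G := Real.sq_sqrt hG.le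
  have hsT : Real.sqrt (Real.sqrt T) ^ 2 = Real.sqrt T := Real.sq_sqrt (Real.sqrt_nonneg _)
  have hG0 : G ≠ 0 := hG.ne'
  have hs0 : Real.sqrt G ≠ 0 := (Real.sqrt_pos.2 hG).ne'
  field_simp
  rw [hsG, hsT]; ring

/-- `kap` is strictly decreasing in `G`. [folklore] -/
theorem kap_lt_kap {T G G' : ℝ} (hT : 0 < T) (hG : 0 < G) (hGG' : G < G') : kap T G' < kap T G := by
  unfold kap
  have hT4 : 0 < Real.sqrt (Real.sqrt T) := Real.sqrt_pos.2 (Real.sqrt_pos.2 hT)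
  have hG' : 0 < G' := hG.trans hGG'
  apply div_lt_div_of_pos_left (by positivity) (by positivity)
  have := Real.sqrt_lt_sqrt hG.le hGG'
  have := Real.sqrt_pos.2 hG
  nlinarith

/-- **From `|κ - κ'|` to `|G - G'|`:** if `κ = kap T G`, `κ' = kap T G'` with `G₀ ≤ G, G' ≤ λ G₀`
(`G₀ > 0`, `λ ≥ 1`), then `|G - G'| ≤ (2/3) λ⁶ G₀ · |κ - κ'| / kap T G₀`.
(Algebra: `G³κ² = G'³κ'²`, so `|G³ - G'³| κ_min² ≤ G_max³ |κ² - κ'²|`.) [folklore] -/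
theorem abs_sub_le_of_kap {T G G' G₀ lam : ℝ} (hT : 0 < T) (hG₀ : 0 < G₀) (hlam : 1 ≤ lam)
    (hG : G₀ ≤ G) (hGu : G ≤ lam * G₀) (hG' : G₀ ≤ G') (hG'u : G' ≤ lam * G₀) :
    |G - G'| ≤ 2 / 3 * lam ^ 6 * G₀ * (|kap T G - kap T G'| / kap T G₀) := by
  have hGpos : 0 < G := hG₀.trans_le hG
  have hG'pos : 0 < G' := hG₀.trans_le hG'
  set κ := kap T G with hκ
  set κ' := kap T G' with hκ'
  set κ₀ := kap T G₀ with hκ₀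
  set κ₁ := kap T (lam * G₀) with hκ₁
  have hκ₀pos : 0 < κ₀ := kap_pos hT hG₀
  have hκ₁pos : 0 < κ₁ := kap_pos hT (by positivity)
  have hκpos : 0 < κ := kap_pos hT hGpos
  have hκ'pos : 0 < κ' := kap_pos hT hG'pos
  have anti : ∀ {u v : ℝ}, 0 < u → u ≤ v → kap T v ≤ kap T u := fun {u v} hu huv => by
    rcases huv.lt_or_eq with h | h
    · exact (kap_lt_kap hT hu h).le
    · rw [h]
  have hκle : κ ≤ κ₀ := anti hG₀ hG
  have hκ'le : κ' ≤ κ₀ := anti hG₀ hG'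
  have hκge : κ₁ ≤ κ := anti hGpos hGu
  have c0 := cube_mul_kap_sq T hG₀
  have c1 := cube_mul_kap_sq T (show 0 < lam * G₀ by positivity)
  have cG := cube_mul_kap_sq T hGpos
  have cG' := cube_mul_kap_sq T hG'pos
  rw [← hκ₀] at c0; rw [← hκ₁] at c1; rw [← hκ] at cG; rw [← hκ'] at cG'
  have hκ₀₁ : κ₀ ^ 2 = lam ^ 3 * κ₁ ^ 2 := by
    have : (lam * G₀) ^ 3 * κ₁ ^ 2 = G₀ ^ 3 * κ₀ ^ 2 := by rw [c1, c0]
    have hG3 : 0 < G₀ ^ 3 := by positivity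
    nlinarith [this]
  have hdiff3 : |G ^ 3 - G' ^ 3| * κ₁ ^ 2 ≤ (lam * G₀) ^ 3 * (|κ - κ'| * (2 * κ₀)) := by
    have e : (G ^ 3 - G' ^ 3) * κ ^ 2 = G' ^ 3 * (κ' ^ 2 - κ ^ 2) := by nlinarith [cG, cG']
    have h1 : |G ^ 3 - G' ^ 3| * κ ^ 2 = G' ^ 3 * |κ' ^ 2 - κ ^ 2| := by
      calc |G ^ 3 - G' ^ 3| * κ ^ 2 = |G ^ 3 - G' ^ 3| * |κ ^ 2| := by rw [abs_of_pos (pow_pos hκpos 2)]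
        _ = |(G ^ 3 - G' ^ 3) * κ ^ 2| := (abs_mul _ _).symm
        _ = |G' ^ 3 * (κ' ^ 2 - κ ^ 2)| := by rw [e]
        _ = G' ^ 3 * |κ' ^ 2 - κ ^ 2| := by rw [abs_mul, abs_of_pos (pow_pos hG'pos 3)]
    have h2 : |κ' ^ 2 - κ ^ 2| = |κ - κ'| * (κ + κ') := by
      rw [show κ' ^ 2 - κ ^ 2 = (κ' - κ) * (κ + κ') by ring, abs_mul, abs_of_pos (add_pos hκpos hκ'pos),
        abs_sub_comm]
    have h3 : |G ^ 3 - G' ^ 3| * κ₁ ^ 2 ≤ |G ^ 3 - G' ^ 3| * κ ^ 2 := by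
      apply mul_le_mul_of_nonneg_left _ (abs_nonneg _)
      exact pow_le_pow_left₀ hκ₁pos.le hκge 2
    have h4 : G' ^ 3 * (|κ - κ'| * (κ + κ')) ≤ (lam * G₀) ^ 3 * (|κ - κ'| * (2 * κ₀)) := by
      apply mul_le_mul (pow_le_pow_left₀ hG'pos.le hG'u 3) _ (by positivity) (by positivity)
      exact mul_le_mul_of_nonneg_left (by linarith) (abs_nonneg _)
    calc |G ^ 3 - G' ^ 3| * κ₁ ^ 2 ≤ |G ^ 3 - G' ^ 3| * κ ^ 2 := h3
      _ = G' ^ 3 * (|κ - κ'| * (κ + κ')) := by rw [h1, h2]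
      _ ≤ _ := h4
  have hfactor : |G - G'| * (3 * G₀ ^ 2) ≤ |G ^ 3 - G' ^ 3| := by
    have e : G ^ 3 - G' ^ 3 = (G - G') * (G ^ 2 + G * G' + G' ^ 2) := by ring
    rw [e, abs_mul, abs_of_pos (show 0 < G ^ 2 + G * G' + G' ^ 2 by positivity)]
    apply mul_le_mul_of_nonneg_left _ (abs_nonneg _)
    nlinarith [mul_le_mul hG hG' hG₀.le hGpos.le, pow_le_pow_left₀ hG₀.le hG 2, pow_le_pow_left₀ hG₀.le hG' 2]
  have hmain : |G - G'| * (3 * G₀ ^ 2) * κ₁ ^ 2 ≤ 2 * lam ^ 3 * G₀ ^ 3 * κ₀ * |κ - κ'| := by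
    calc |G - G'| * (3 * G₀ ^ 2) * κ₁ ^ 2 ≤ |G ^ 3 - G' ^ 3| * κ₁ ^ 2 :=
          mul_le_mul_of_nonneg_right hfactor (sq_nonneg _)
      _ ≤ (lam * G₀) ^ 3 * (|κ - κ'| * (2 * κ₀)) := hdiff3
      _ = 2 * lam ^ 3 * G₀ ^ 3 * κ₀ * |κ - κ'| := by ring
  have hpos : 0 < 3 * G₀ ^ 2 * κ₁ ^ 2 := by positivity
  refine le_of_mul_le_mul_right ?_ hpos
  have e : 2 / 3 * lam ^ 6 * G₀ * (|κ - κ'| / κ₀) * (3 * G₀ ^ 2 * κ₁ ^ 2) =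
      2 * lam ^ 3 * G₀ ^ 3 * κ₀ * |κ - κ'| := by
    have h6 : lam ^ 6 * κ₁ ^ 2 = lam ^ 3 * κ₀ ^ 2 := by rw [hκ₀₁]; ring
    have : 2 / 3 * lam ^ 6 * G₀ * (|κ - κ'| / κ₀) * (3 * G₀ ^ 2 * κ₁ ^ 2) =
        2 * G₀ ^ 3 * (lam ^ 6 * κ₁ ^ 2) * |κ - κ'| / κ₀ := by ring
    rw [this, h6]
    field_simp
  rw [e]
  calc |G - G'| * (3 * G₀ ^ 2 * κ₁ ^ 2) = |G - G'| * (3 * G₀ ^ 2) * κ₁ ^ 2 := by ring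
    _ ≤ _ := hmain

/-! ### The spacing function `h(x) = (2x)^{1/2}` of the third coordinate -/

/-- For `F = log` the function of Lemma 7.18 is `h(x) = (2x)^{1/2}` (`q h(r/q) ≈ q(2|f''/2|)^{1/2} = G`):
it satisfies the hypotheses of Lemma 7.18 on `I = [A/2C, 2A/C]` with `H_h = (A/C)^{1/2}`, `C₀ = 4`
(`x h' = h/2`, `h - x h' = h/2`). [cite: GrahamKolesnik1991, Lemma 7.18 (hypotheses), §7.7] -/
theorem isSpacingFn_sqrt {A C : ℝ} (hA : 0 < A) (hC : 0 < C) :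
    IsSpacingFn A C (Real.sqrt (A / C)) 4 (Set.Icc (A / (2 * C)) (2 * A / C))
      (fun x => Real.sqrt (2 * x)) (fun x => 1 / Real.sqrt (2 * x)) := by
  have hAC : 0 < A / C := div_pos hA hC
  have hs : 0 < Real.sqrt (A / C) := Real.sqrt_pos.2 hAC
  have hx0 : ∀ x ∈ Set.Icc (A / (2 * C)) (2 * A / C), 0 < x := fun x hx =>
    lt_of_lt_of_le (by positivity) hx.1
  -- `√(A/C) ≤ √(2x) ≤ 2√(A/C)` on `I`
  have hlow : ∀ x ∈ Set.Icc (A / (2 * C)) (2 * A / C), Real.sqrt (A / C) ≤ Real.sqrt (2 * x) := fun x hx => by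
    apply Real.sqrt_le_sqrt
    have := hx.1
    rw [div_le_iff₀ (by positivity)] at this
    rw [div_le_iff₀ hC]
    linarith
  have hup : ∀ x ∈ Set.Icc (A / (2 * C)) (2 * A / C), Real.sqrt (2 * x) ≤ 2 * Real.sqrt (A / C) := fun x hx => by
    rw [show 2 * Real.sqrt (A / C) = Real.sqrt (4 * (A / C)) by
      rw [Real.sqrt_mul (by norm_num), show Real.sqrt 4 = 2 by
        rw [show (4 : ℝ) = 2 ^ 2 by norm_num, Real.sqrt_sq (by norm_num)]]]
    apply Real.sqrt_le_sqrt
    have h' : x ≤ 2 * A / C := hx.2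
    calc 2 * x ≤ 2 * (2 * A / C) := by linarith
      _ = 4 * (A / C) := by ring
  have hxh' : ∀ x ∈ Set.Icc (A / (2 * C)) (2 * A / C), x * (1 / Real.sqrt (2 * x)) = Real.sqrt (2 * x) / 2 :=
    fun x hx => by
    have h2x : 0 < 2 * x := by linarith [hx0 x hx]
    have hsx : 0 < Real.sqrt (2 * x) := Real.sqrt_pos.2 h2x
    have e : Real.sqrt (2 * x) * Real.sqrt (2 * x) = 2 * x := Real.mul_self_sqrt h2x.le
    rw [mul_one_div, div_eq_div_iff hsx.ne' two_ne_zero]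
    nlinarith [e]
  refine ⟨Set.ordConnected_Icc, subset_rfl, ?_, ?_, ?_, ?_, ?_⟩
  · intro x hx
    have h2x : 0 < 2 * x := by linarith [hx0 x hx]
    have hd : HasDerivAt (fun x => Real.sqrt (2 * x)) (1 / (2 * Real.sqrt (2 * x)) * 2) x :=
      (Real.hasDerivAt_sqrt h2x.ne').comp x ((hasDerivAt_id x).const_mul 2 |>.congr_deriv (by simp))
    refine (hd.congr_deriv ?_).hasDerivWithinAt
    field_simp
  · intro x hx
    calc Real.sqrt (A / C) / 4 ≤ Real.sqrt (A / C) := by linarith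
      _ ≤ Real.sqrt (2 * x) := hlow x hx
  · intro x hx
    rw [hxh' x hx, abs_of_pos (by have := Real.sqrt_pos.2 (by linarith [hx0 x hx] : 0 < 2 * x); positivity)]
    linarith [hup x hx]
  · intro x hx
    rw [hxh' x hx, abs_of_pos (by have := Real.sqrt_pos.2 (by linarith [hx0 x hx] : 0 < 2 * x); positivity)]
    linarith [hlow x hx]
  · intro x hx
    rw [hxh' x hx, show Real.sqrt (2 * x) - Real.sqrt (2 * x) / 2 = Real.sqrt (2 * x) / 2 by ring,
      abs_of_pos (by have := Real.sqrt_pos.2 (by linarith [hx0 x hx] : 0 < 2 * x); positivity)]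
    linarith [hlow x hx]


/-- `|√u - √v| (√u + √v) = |u - v|` for `u, v ≥ 0`. [folklore] -/
theorem abs_sqrt_sub_sqrt_mul {u v : ℝ} (hu : 0 ≤ u) (hv : 0 ≤ v) :
    |Real.sqrt u - Real.sqrt v| * (Real.sqrt u + Real.sqrt v) = |u - v| := by
  have e : (Real.sqrt u - Real.sqrt v) * (Real.sqrt u + Real.sqrt v) = u - v := by
    nlinarith [Real.mul_self_sqrt hu, Real.mul_self_sqrt hv]
  rw [← e, abs_mul, abs_of_nonneg (add_nonneg (Real.sqrt_nonneg _) (Real.sqrt_nonneg _))]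

/-- Perturbing the point: `|q√(2x) - q√(2y)| ≤ q |x - y| √2 / √m` if `x, y ≥ m > 0`. [folklore] -/
theorem abs_mul_sqrt_sub_le {q x y m : ℝ} (hq : 0 ≤ q) (hm : 0 < m) (hx : m ≤ x) (hy : m ≤ y) :
    |q * Real.sqrt (2 * x) - q * Real.sqrt (2 * y)| ≤ q * (|x - y| * Real.sqrt 2 / Real.sqrt m) := by
  rw [← mul_sub, abs_mul, abs_of_nonneg hq]
  apply mul_le_mul_of_nonneg_left _ hq
  have hsm : 0 < Real.sqrt m := Real.sqrt_pos.2 hm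
  have hs2m : Real.sqrt (2 * m) ≤ Real.sqrt (2 * x) := Real.sqrt_le_sqrt (by linarith)
  have hs2m' : Real.sqrt (2 * m) ≤ Real.sqrt (2 * y) := Real.sqrt_le_sqrt (by linarith)
  have h2m : Real.sqrt (2 * m) = Real.sqrt 2 * Real.sqrt m := Real.sqrt_mul (by norm_num) _
  have hpos : 0 < Real.sqrt (2 * x) + Real.sqrt (2 * y) := by
    have : 0 < Real.sqrt (2 * m) := Real.sqrt_pos.2 (by linarith); linarith
  have key := abs_sqrt_sub_sqrt_mul (show 0 ≤ 2 * x by linarith) (show 0 ≤ 2 * y by linarith)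
  rw [show 2 * x - 2 * y = 2 * (x - y) by ring, abs_mul, abs_of_pos (by norm_num : (0:ℝ) < 2)] at key
  -- `|√(2x) - √(2y)| = 2|x-y|/(√(2x)+√(2y)) ≤ 2|x-y|/(2√(2m)) = |x-y|/(√2 √m) ≤ |x-y|√2/√m`
  have h1 : |Real.sqrt (2 * x) - Real.sqrt (2 * y)| = 2 * |x - y| / (Real.sqrt (2 * x) + Real.sqrt (2 * y)) := by
    rw [eq_div_iff hpos.ne']; exact key
  rw [h1, div_le_div_iff₀ hpos hsm]
  have hs2 : Real.sqrt 2 * Real.sqrt 2 = 2 := Real.mul_self_sqrt (by norm_num)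
  have hxy : 0 ≤ |x - y| := abs_nonneg _
  -- `2|x-y|√m ≤ |x-y|√2 (√(2x)+√(2y))`, using `√(2x)+√(2y) ≥ 2√2√m`
  have hsum : 2 * Real.sqrt 2 * Real.sqrt m ≤ Real.sqrt (2 * x) + Real.sqrt (2 * y) := by
    rw [h2m] at hs2m hs2m'; linarith
  calc 2 * |x - y| * Real.sqrt m ≤ 4 * |x - y| * Real.sqrt m := by nlinarith [mul_nonneg hxy hsm.le]
    _ = |x - y| * Real.sqrt 2 * (2 * Real.sqrt 2 * Real.sqrt m) := by
        rw [show |x - y| * Real.sqrt 2 * (2 * Real.sqrt 2 * Real.sqrt m) =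
          2 * (Real.sqrt 2 * Real.sqrt 2) * |x - y| * Real.sqrt m by ring, hs2]; ring
    _ ≤ |x - y| * Real.sqrt 2 * (Real.sqrt (2 * x) + Real.sqrt (2 * y)) :=
        mul_le_mul_of_nonneg_left hsum (mul_nonneg hxy (Real.sqrt_nonneg 2))

/-! ### The second spacing count of a family of blocks -/

/-- The tolerance `Δ₂` of (7.5.3) produced by `|x₃ - x₃'| < 1/(12H^{3/2})` for a family with
numerators `∼ A`, denominators `∼ C` (`G₀ = (AC)^{1/2}/2`, ratio `λ = 9`) and points `η`-close to
their rationals. [folklore] -/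
def delta2 (T A C η : ℝ) (H : ℕ) : ℝ :=
  (2 / 3 * 9 ^ 6 * (Real.sqrt (A * C) / 2) * ((1 / (12 * (H : ℝ) ^ (3 / 2 : ℝ))) / kap T (Real.sqrt (A * C) / 2))
    + 8 * Real.sqrt 2 * η * C * Real.sqrt C / Real.sqrt A) / Real.sqrt (A * C)

/-- **The second spacing count of a family of Huxley–Watt blocks is dominated by Graham–Kolesnik's
`B`.** Consider finitely many blocks `k ∈ 𝓕` with data: a point `x_k > 0` (`= |f''|/2` at the block),
a reduced rational `r_k/q_k` with `|x_k - r_k/q_k| ≤ η`, `A < r_k ≤ 2A`, `C < q_k ≤ 2C`, an inverse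
`ā_k` of `a_k = -r_k (mod q_k)`, at most `m₀` blocks per rational, and a vector `x(k) ∈ ℝ⁴` whose
second coordinate is `-ā_k/(4q_k)` modulo `1` and whose third is `-κ_k`,
`κ_k = (2/3)T^{1/4} (q_k(2x_k)^{1/2})^{-3/2}` (the shape produced by `HSumStructure.xvec` for
`F = log`, where `μ = T/(3m³)`, `x = T/(2m²)`). Then Bourgain's count `B_V` (pairs with
`|x_j(k) - x_j(k')| < 1/(2Y_{V,j})`, `j ≤ 4`) is at most `m₀²` times the number of pairs of the
configuration `𝓟(A, C, [A/2C, 2A/C])` satisfying (7.5.2) with `Δ₁ = 1/(3H²V)` and (7.5.3) for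
`h(x) = (2x)^{1/2}` with `Δ₂ = delta2 T A C η H` — the input of `GrahamKolesnik_lemma718_general`.
[cite: BourgainJAMS2017, §4 (3.9), (3.11)] [cite: GrahamKolesnik1991, §7.7 (reduction to Lemma 7.18)] -/
theorem secondSpacingCount_le_pairCount {T A C η : ℝ} (hT : 0 < T) (hA : 1 ≤ A) (hC : 1 ≤ C)
    (hηx : η ≤ A / (4 * C)) (𝓕 : Finset ℕ) (x : ℕ → Fin 4 → ℝ) (r : ℕ → ℤ) (q : ℕ → ℕ) (xpt : ℕ → ℝ)
    (abar n : ℕ → ℤ) (m₀ H : ℕ) (hH : 1 ≤ H) {V : ℝ} (hV : 1 ≤ V)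
    (hr : ∀ k ∈ 𝓕, A < r k ∧ (r k : ℝ) ≤ 2 * A) (hq : ∀ k ∈ 𝓕, C < q k ∧ (q k : ℝ) ≤ 2 * C)
    (hcop : ∀ k ∈ 𝓕, IsCoprime (r k) (q k)) (hinv : ∀ k ∈ 𝓕, -(r k) * abar k ≡ 1 [ZMOD q k])
    (hxpt : ∀ k ∈ 𝓕, |xpt k - r k / q k| ≤ η)
    (hx1 : ∀ k ∈ 𝓕, x k 1 = -(abar k : ℝ) / (4 * q k) - n k)
    (hx2 : ∀ k ∈ 𝓕, x k 2 = -kap T (q k * Real.sqrt (2 * xpt k)))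
    (hfib : ∀ pt : ℤ × ℤ, (𝓕.filter (fun k => ((r k, (q k : ℤ)) : ℤ × ℤ) = pt)).card ≤ m₀) :
    bourgainSecondSpacingCount 𝓕 x H V ≤
      m₀ ^ 2 * pairCount A C (1 / (3 * (H : ℝ) ^ 2 * V)) (delta2 T A C η H) (Real.sqrt (A / C))
        (Set.Icc (A / (2 * C)) (2 * A / C)) (fun x => Real.sqrt (2 * x)) := by
  classical
  have hA0 : 0 < A := by linarith
  have hC0 : 0 < C := by linarith
  set I : Set ℝ := Set.Icc (A / (2 * C)) (2 * A / C) with hI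
  set P := points A C I with hP
  set Δ₁ : ℝ := 1 / (3 * (H : ℝ) ^ 2 * V) with hΔ₁
  set Δ₂ : ℝ := delta2 T A C η H with hΔ₂
  set hf : ℝ → ℝ := fun x => Real.sqrt (2 * x) with hhf
  set good := goodPairs A C Δ₁ Δ₂ (Real.sqrt (A / C)) I hf with hgood
  -- membership of the points
  have hmem : ∀ k ∈ 𝓕, ((r k, (q k : ℤ)) : ℤ × ℤ) ∈ P := by
    intro k hk
    rw [hP, mem_points]
    obtain ⟨hr1, hr2⟩ := hr k hk
    obtain ⟨hq1, hq2⟩ := hq k hk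
    have hqpos : (0 : ℝ) < q k := hC0.trans hq1
    refine ⟨⟨by exact_mod_cast hr1, by exact_mod_cast hr2⟩, ⟨by exact_mod_cast hq1, by exact_mod_cast hq2⟩,
      hcop k hk, ?_⟩
    show (A / (2 * C) ≤ ((r k : ℤ) : ℝ) / ((q k : ℕ) : ℤ) ∧ ((r k : ℤ) : ℝ) / ((q k : ℕ) : ℤ) ≤ 2 * A / C)
    push_cast
    constructor
    · rw [div_le_div_iff₀ (by positivity) hqpos]; nlinarith
    · rw [div_le_div_iff₀ hqpos hC0]; nlinarith
  refine count_le_of_fibers (p := fun k => ((r k, (q k : ℤ)) : ℤ × ℤ)) (P := P) (good := good)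
    (fun pt _ => hfib pt) ?_ ?_
  swap
  · rw [hgood]; unfold SecondSpacing.goodPairs; exact Finset.filter_subset _ _
  intro k hk k' hk' hclose
  rw [hgood, mem_goodPairs]
  refine ⟨hmem k hk, hmem k' hk', ?_, ?_⟩
  · -- (7.5.2) from the second coordinate
    have h1 := hclose 1
    have hY : (2 * bourgainYBound H V 1)⁻¹ = Δ₁ / 4 := by
      show (2 * (6 * (H : ℝ) ^ 2 * V))⁻¹ = 1 / (3 * (H : ℝ) ^ 2 * V) / 4
      field_simp; ring
    rw [hY] at h1
    have := invClose_of_x2 (q := q k) (q' := q k') (by have := (hq k hk).1; exact_mod_cast hC0.trans this)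
      (by have := (hq k' hk').1; exact_mod_cast hC0.trans this) (a := -(r k)) (a' := -(r k'))
      (hinv k hk) (hinv k' hk') (hx1 k hk) (hx1 k' hk') h1
    simp only [neg_neg] at this
    rw [show 4 * (Δ₁ / 4) = Δ₁ by ring] at this
    exact this
  · -- (7.5.3) from the third coordinate
    have h2 := hclose 2
    have hY : (2 * bourgainYBound H V 2)⁻¹ = 1 / (12 * (H : ℝ) ^ (3 / 2 : ℝ)) := by
      show (2 * (6 * (H : ℝ) ^ (3 / 2 : ℝ)))⁻¹ = 1 / (12 * (H : ℝ) ^ (3 / 2 : ℝ))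
      rw [one_div]; ring
    rw [hY, hx2 k hk, hx2 k' hk', show ∀ u v : ℝ, -u - -v = -(u - v) from fun u v => by ring, abs_neg] at h2
    -- ranges of the points
    have hrq : ∀ j ∈ 𝓕, A / (2 * C) ≤ (r j : ℝ) / q j ∧ (r j : ℝ) / q j ≤ 2 * A / C := fun j hj => by
      obtain ⟨hr1, hr2⟩ := hr j hj
      obtain ⟨hq1, hq2⟩ := hq j hj
      have hqpos : (0 : ℝ) < q j := hC0.trans hq1
      constructor
      · rw [div_le_div_iff₀ (by positivity) hqpos]; nlinarith
      · rw [div_le_div_iff₀ hqpos hC0]; nlinarith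
    have hxr : ∀ j ∈ 𝓕, A / (4 * C) ≤ xpt j ∧ xpt j ≤ 9 * A / (4 * C) := fun j hj => by
      have h := abs_le.1 (hxpt j hj)
      obtain ⟨l, u⟩ := hrq j hj
      have e1 : A / (2 * C) - A / (4 * C) = A / (4 * C) := by field_simp; ring
      have e2 : 2 * A / C + A / (4 * C) = 9 * A / (4 * C) := by field_simp; ring
      constructor <;> linarith
    -- `G₀ ≤ G_j ≤ 9 G₀`, `G₀ = √(AC)/2`
    set G₀ : ℝ := Real.sqrt (A * C) / 2 with hG₀
    have hAC : Real.sqrt (A * C) = Real.sqrt A * Real.sqrt C := Real.sqrt_mul hA0.le _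
    have hsA : 0 < Real.sqrt A := Real.sqrt_pos.2 hA0
    have hsC : 0 < Real.sqrt C := Real.sqrt_pos.2 hC0
    have hG₀pos : 0 < G₀ := by rw [hG₀]; positivity
    have hCC : Real.sqrt C * Real.sqrt C = C := Real.mul_self_sqrt hC0.le
    have hGrange : ∀ j ∈ 𝓕, G₀ ≤ q j * Real.sqrt (2 * xpt j) ∧ q j * Real.sqrt (2 * xpt j) ≤ 9 * G₀ := by
      intro j hj
      obtain ⟨hq1, hq2⟩ := hq j hj
      obtain ⟨hx1', hx2'⟩ := hxr j hj
      have hqpos : (0 : ℝ) < q j := hC0.trans hq1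
      -- `√(A/(2C)) ≤ √(2 xpt) ≤ √(9A/(2C))`
      have hl : Real.sqrt A / Real.sqrt C / Real.sqrt 2 ≤ Real.sqrt (2 * xpt j) := by
        rw [← Real.sqrt_div hA0.le, ← Real.sqrt_div (div_nonneg hA0.le hC0.le)]
        apply Real.sqrt_le_sqrt
        rw [div_div, div_le_iff₀ (by positivity)]
        rw [div_le_iff₀ (by positivity)] at hx1'
        linarith
      have hu : Real.sqrt (2 * xpt j) ≤ 3 * (Real.sqrt A / Real.sqrt C) / Real.sqrt 2 := by
        rw [← Real.sqrt_div hA0.le, show (3 : ℝ) = Real.sqrt 9 by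
          rw [show (9:ℝ) = 3 ^ 2 by norm_num, Real.sqrt_sq (by norm_num)], ← Real.sqrt_mul (by norm_num),
          ← Real.sqrt_div (by positivity)]
        apply Real.sqrt_le_sqrt
        rw [le_div_iff₀ (by positivity)]
        have h' : xpt j * (4 * C) ≤ 9 * A := by rwa [le_div_iff₀ (by positivity)] at hx2'
        rw [show 9 * (A / C) = 9 * A / C by ring, le_div_iff₀ hC0]
        nlinarith
      have hs2' : Real.sqrt 2 ≤ 2 := by
        rw [Real.sqrt_le_left (by norm_num)]; norm_num
      have hs43 : 4 / 3 ≤ Real.sqrt 2 := by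
        rw [Real.le_sqrt (by norm_num) (by norm_num)]; norm_num
      have hs2pos : 0 < Real.sqrt 2 := by positivity
      have hCC : Real.sqrt C * Real.sqrt C = C := Real.mul_self_sqrt hC0.le
      have idl : C * (Real.sqrt A / Real.sqrt C / Real.sqrt 2) = Real.sqrt A * Real.sqrt C / Real.sqrt 2 := by
        rw [div_div, mul_div_assoc', div_eq_div_iff (by positivity) (by positivity)]
        linear_combination (-(Real.sqrt A * Real.sqrt 2)) * hCC
      have idu : (2 * C) * (3 * (Real.sqrt A / Real.sqrt C) / Real.sqrt 2) = 6 * (Real.sqrt A * Real.sqrt C) / Real.sqrt 2 := by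
        rw [mul_div_assoc', div_left_inj' hs2pos.ne', mul_div_assoc', mul_div_assoc', div_eq_iff hsC.ne']
        linear_combination (-(6 * Real.sqrt A)) * hCC
      have hACpos : 0 < Real.sqrt A * Real.sqrt C := by positivity
      constructor
      · have step : G₀ ≤ C * (Real.sqrt A / Real.sqrt C / Real.sqrt 2) := by
          rw [idl, hG₀, hAC, div_le_div_iff₀ (by norm_num) hs2pos]
          nlinarith
        calc G₀ ≤ C * (Real.sqrt A / Real.sqrt C / Real.sqrt 2) := step
          _ ≤ q j * Real.sqrt (2 * xpt j) := mul_le_mul hq1.le hl (by positivity) hqpos.le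
      · calc (q j : ℝ) * Real.sqrt (2 * xpt j) ≤ (2 * C) * (3 * (Real.sqrt A / Real.sqrt C) / Real.sqrt 2) :=
              mul_le_mul hq2 hu (Real.sqrt_nonneg _) (by positivity)
          _ ≤ 9 * G₀ := by
              rw [idu, hG₀, hAC, mul_div_assoc', div_le_div_iff₀ hs2pos (by norm_num)]
              nlinarith
    obtain ⟨hGk, hGk'⟩ := hGrange k hk
    obtain ⟨hGl, hGl'⟩ := hGrange k' hk'
    have hGG := abs_sub_le_of_kap (T := T) hT hG₀pos (by norm_num : (1:ℝ) ≤ 9) hGk hGk' hGl hGl'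
    -- the `η`-perturbations
    have hm : 0 < A / (4 * C) := by positivity
    have h42 : A / (4 * C) ≤ A / (2 * C) := div_le_div_of_nonneg_left hA0.le (by positivity) (by linarith)
    have hpk := abs_mul_sqrt_sub_le (q := (q k : ℝ)) (Nat.cast_nonneg _) hm (hxr k hk).1
      (show A / (4 * C) ≤ (r k : ℝ) / q k by linarith [(hrq k hk).1])
    have hpk' := abs_mul_sqrt_sub_le (q := (q k' : ℝ)) (Nat.cast_nonneg _) hm (hxr k' hk').1
      (show A / (4 * C) ≤ (r k' : ℝ) / q k' by linarith [(hrq k' hk').1])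
    -- assemble (7.5.3)
    show HClose C (Real.sqrt (A / C)) Δ₂ hf (r k, (q k : ℤ)) (r k', (q k' : ℤ))
    unfold SecondSpacing.HClose
    simp only [hhf]
    push_cast
    set Qr : ℝ := (q k : ℝ) * Real.sqrt (2 * ((r k : ℝ) / q k)) with hQr
    set Qx : ℝ := (q k : ℝ) * Real.sqrt (2 * xpt k) with hQx
    set Qr' : ℝ := (q k' : ℝ) * Real.sqrt (2 * ((r k' : ℝ) / q k')) with hQr'
    set Qx' : ℝ := (q k' : ℝ) * Real.sqrt (2 * xpt k') with hQx'
    have tri : |Qr - Qr'| ≤ |Qx - Qr| + |Qx - Qx'| + |Qx' - Qr'| := by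
      have t1 := abs_sub_le Qr Qx Qr'
      have t2 := abs_sub_le Qx Qx' Qr'
      rw [abs_sub_comm Qr Qx] at t1
      linarith
    refine tri.trans ?_
    -- bound each piece
    have hq2 : (q k : ℝ) ≤ 2 * C := (hq k hk).2
    have hq2' : (q k' : ℝ) ≤ 2 * C := (hq k' hk').2
    have hηk : |xpt k - (r k : ℝ) / q k| ≤ η := hxpt k hk
    have hηk' : |xpt k' - (r k' : ℝ) / q k'| ≤ η := hxpt k' hk'
    have hsm : 0 < Real.sqrt (A / (4 * C)) := Real.sqrt_pos.2 hm
    have hs4 : Real.sqrt (A / (4 * C)) = Real.sqrt A / (2 * Real.sqrt C) := by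
      rw [Real.sqrt_div hA0.le, Real.sqrt_mul (by norm_num), show Real.sqrt 4 = 2 by
        rw [show (4:ℝ) = 2 ^ 2 by norm_num, Real.sqrt_sq (by norm_num)]]
    have e1 : 2 * C * (η * Real.sqrt 2 / Real.sqrt (A / (4 * C))) = 4 * Real.sqrt 2 * η * C * Real.sqrt C / Real.sqrt A := by
      rw [hs4]; field_simp; ring
    have p1 : |Qx - Qr| ≤ 4 * Real.sqrt 2 * η * C * Real.sqrt C / Real.sqrt A := by
      rw [← e1]
      refine hpk.trans (mul_le_mul hq2 ?_ (by positivity) (by positivity))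
      exact div_le_div_of_nonneg_right (mul_le_mul_of_nonneg_right hηk (Real.sqrt_nonneg _)) hsm.le
    have p3 : |Qx' - Qr'| ≤ 4 * Real.sqrt 2 * η * C * Real.sqrt C / Real.sqrt A := by
      rw [← e1]
      refine hpk'.trans (mul_le_mul hq2' ?_ (by positivity) (by positivity))
      exact div_le_div_of_nonneg_right (mul_le_mul_of_nonneg_right hηk' (Real.sqrt_nonneg _)) hsm.le
    have hκ₀ := kap_pos hT hG₀pos
    have p2 : |Qx - Qx'| ≤ 2 / 3 * 9 ^ 6 * G₀ * ((1 / (12 * (H : ℝ) ^ (3 / 2 : ℝ))) / kap T G₀) :=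
      hGG.trans (mul_le_mul_of_nonneg_left (div_le_div_of_nonneg_right h2.le hκ₀.le) (by positivity))
    -- the right-hand side `C √(A/C) Δ₂ = X + Y`
    have hCs : C * Real.sqrt (A / C) = Real.sqrt (A * C) := by
      rw [Real.sqrt_div hA0.le, hAC, mul_div_assoc', div_eq_iff hsC.ne']
      linear_combination (-(Real.sqrt A)) * hCC
    have hsAC : Real.sqrt (A * C) ≠ 0 := by rw [hAC]; positivity
    have htot : C * Real.sqrt (A / C) * Δ₂ =
        2 / 3 * 9 ^ 6 * G₀ * ((1 / (12 * (H : ℝ) ^ (3 / 2 : ℝ))) / kap T G₀)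
          + 8 * Real.sqrt 2 * η * C * Real.sqrt C / Real.sqrt A := by
      rw [hCs, hΔ₂, delta2, ← hG₀, mul_div_assoc', mul_div_cancel_left₀ _ hsAC]
    rw [htot]
    have : (8 : ℝ) * Real.sqrt 2 * η * C * Real.sqrt C / Real.sqrt A =
        4 * Real.sqrt 2 * η * C * Real.sqrt C / Real.sqrt A + 4 * Real.sqrt 2 * η * C * Real.sqrt C / Real.sqrt A := by
      ring
    rw [this]
    linarith [p1, p2, p3]

/-- **Corollary: Bourgain's (3.11)-type bound for the family, from Graham–Kolesnik's Lemma 7.18.**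
Under the hypotheses of `secondSpacingCount_le_pairCount`,
`B_V ≤ m₀² K ((Δ₁Δ₂ + Δ₁²) A C²(A + C) + AC + Δ₂(A² + C²))` with `Δ₁ = 1/(3H²V)`,
`Δ₂ = delta2 T A C η H` and an absolute `K` (that of `GrahamKolesnik_lemma718_general` with `C₀ = 4`).
[cite: BourgainJAMS2017, §4 (3.11)] [cite: GrahamKolesnik1991, Lemma 7.18] -/
theorem secondSpacingCount_le :
    ∃ K : ℝ, 0 < K ∧ ∀ {T A C η : ℝ}, 0 < T → 1 ≤ A → 1 ≤ C → η ≤ A / (4 * C) →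
      ∀ (𝓕 : Finset ℕ) (x : ℕ → Fin 4 → ℝ) (r : ℕ → ℤ) (q : ℕ → ℕ) (xpt : ℕ → ℝ) (abar n : ℕ → ℤ) (m₀ H : ℕ),
      1 ≤ H → ∀ {V : ℝ}, 1 ≤ V → 0 ≤ delta2 T A C η H →
      (∀ k ∈ 𝓕, A < r k ∧ (r k : ℝ) ≤ 2 * A) → (∀ k ∈ 𝓕, C < q k ∧ (q k : ℝ) ≤ 2 * C) →
      (∀ k ∈ 𝓕, IsCoprime (r k) (q k)) → (∀ k ∈ 𝓕, -(r k) * abar k ≡ 1 [ZMOD q k]) →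
      (∀ k ∈ 𝓕, |xpt k - r k / q k| ≤ η) →
      (∀ k ∈ 𝓕, x k 1 = -(abar k : ℝ) / (4 * q k) - n k) →
      (∀ k ∈ 𝓕, x k 2 = -kap T (q k * Real.sqrt (2 * xpt k))) →
      (∀ pt : ℤ × ℤ, (𝓕.filter (fun k => ((r k, (q k : ℤ)) : ℤ × ℤ) = pt)).card ≤ m₀) →
      (bourgainSecondSpacingCount 𝓕 x H V : ℝ) ≤
        m₀ ^ 2 * (K * ((1 / (3 * (H : ℝ) ^ 2 * V) * delta2 T A C η H + (1 / (3 * (H : ℝ) ^ 2 * V)) ^ 2)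
          * (A * C ^ 2 * (A + C)) + A * C + delta2 T A C η H * A ^ 2 + delta2 T A C η H * C ^ 2)) := by
  obtain ⟨K, hK, hB⟩ := GrahamKolesnik_lemma718_general (C₀ := 4) (by norm_num)
  refine ⟨K, hK, ?_⟩
  intro T A C η hT hA hC hηx 𝓕 x r q xpt abar n m₀ H hH V hV hΔ₂ hr hq hcop hinv hxpt hx1 hx2 hfib
  have h1 := secondSpacingCount_le_pairCount hT hA hC hηx 𝓕 x r q xpt abar n m₀ H hH hV hr hq hcop hinv hxpt
    hx1 hx2 hfib
  have hA0 : 0 < A := by linarith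
  have hC0 : 0 < C := by linarith
  have h2 := hB A C (1 / (3 * (H : ℝ) ^ 2 * V)) (delta2 T A C η H) (Real.sqrt (A / C))
    (Set.Icc (A / (2 * C)) (2 * A / C)) (fun x => Real.sqrt (2 * x)) (fun x => 1 / Real.sqrt (2 * x))
    hA hC (by positivity) hΔ₂ (Real.sqrt_pos.2 (div_pos hA0 hC0)) (isSpacingFn_sqrt hA0 hC0)
  calc (bourgainSecondSpacingCount 𝓕 x H V : ℝ)
      ≤ ((m₀ ^ 2 * pairCount A C (1 / (3 * (H : ℝ) ^ 2 * V)) (delta2 T A C η H) (Real.sqrt (A / C))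
          (Set.Icc (A / (2 * C)) (2 * A / C)) (fun x => Real.sqrt (2 * x)) : ℕ) : ℝ) := by exact_mod_cast h1
    _ ≤ _ := by push_cast; exact mul_le_mul_of_nonneg_left h2 (by positivity)

end SecondSpacingLog
end Literature.NumberTheory.LFunctions
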